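import Literature.MathematicalPhysics.QuantumFieldTheory.Balaban1983to89.B14Eq347Letters
import Literature.MathematicalPhysics.QuantumFieldTheory.Balaban1983to89.TreeLengthTorusGeometry

/-!
# `Balaban1983to89.B14.Eq347Torus` — [Balaban1988Convergent] (3.44)–(3.47) pp. 277–278 and «The terms of the sum
# above satisfy the bounds (2.42), with the constant B₀ replaced by O(p₀³(g_k))» ON BAŁABAN'S PERIODIC CARRIER: the
# torus instance of the tree's (3.44)–(3.47) chain and of the letters-only (3.47) bound (`…B14Eq344PolymerRatio` §Window ∕
# `…B14.Eq347Letters` are the WINDOW instances; this file is their twin on `TreeLengthTorus.tsys` ∕ `TreeLengthTorusGeometry.TTouch`)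

HONEST FRAMING (cell `pub-ymgap`, Track A DAG node N11 = [B14]; count-neutral SLOT input).  Instantiation of landed
ABSTRACT kernel theorems (`B14Eq344PolymerRatio.eq346`, `eq347`, `norm_E0_le`, `E0_filter_support`;
`B13Resummation.norm_locE_le`, `kp_condition`) on the torus carrier of unit pv22 (`TreeLengthTorus`: cubes (ℤ∕N)^d,
torus localization domains `TDom d N`, tree length `torusTreeLen`; `TreeLengthTorusGeometry`: incompatibility `TTouch`,
reach `treach`, the polymer geometry `tgeometry` with (1.26), the volume bound and (2.27) PROVED) plus the torus geometry
the bound needs; no estimate of Bałaban's is re-derived.  The identification of `torusTreeLen` with print's d_j rests on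
pv22's covering-space reading (cell DIVERGENCE D-pv22g2.1), inherited; the ACTIVITY LETTERS are hypotheses (in print the
output of «Lemmas 5, 6 [I] with the corresponding changes», p. 276 = [Balaban1988RG2Cluster] at the covers of p. 275 —
node N10 ∕ the `smallFieldInductive` in-edge); nothing of Bałaban's minimizers `U_k` or fluctuation integrals is
instantiated; one finite T⁴ programme at fixed ε; nothing here is a claim about the continuum, ℝ⁴, OS axioms, a mass
gap or the Clay problem.

CITATION HEADER (lean-in-tree rule).  T. Bałaban, *Convergent renormalization expansions for lattice gauge theories*,
Commun. Math. Phys. **119** (1988) 243–285, doi:10.1007/bf01217741 [Balaban1988Convergent] (cell paper B14 = «[III]»;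
held text `paper:balaban1988-cmp119-convergent-renormalization`, journal page = PDF page + 242; pp. 277–278 [PDF 35–36]
read from the text layer by the author of this file, 2026-08-26).  THE PRINT, verbatim (p. 278): *«In the sum (3.44) we
separate the summation over Z₀, and for a fixed Z₀ we consider the remaining sum over {Z₁,…,Z_n}. … This condition can be
formulated as Z_i ⊂ Z̄₀ᶜ, where Z̄₀ᶜ is the union of all cubes from π_k, such that they do not intersect Z₀, or intersect it
along a two-dimensional edge at most. The sum is exponentiated … [the expectation value in (3.37)] = Σ_{Z₀⊃b} H′(Z₀)
exp[Ẽ^{(k+1)}(Λ_{k+1}, Z̄₀ᶜ) − Ẽ^{(k+1)}(Λ_{k+1})]. (3.45) … = Σ_{Z₀⊃b} H′(Z₀) exp[−Σ_Y Ẽ^{(k+1)}(Λ_{k+1}, Y)]. (3.46) …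
This, after the proper resummation, yields the representation [the expectation value in (3.37)] = Σ_{X∈𝐃_{k+1}, X⊃b}
𝐄₀^{(k+1)}(Λ_{k+1}, X, b). (3.47) … The terms of the sum above satisfy the bounds (2.42), with the constant B₀ replaced by
O(p₀³(g_k)).»*  The carrier is the periodic lattice of [Balaban1987RG1] p. 251 (*«a torus T obtained by the usual
identification of boundary points»*), localization domains and d_j of p. 257, as typed in `TreeLengthTorus`.

BY NAME AND UNCHANGED.  `…B14Eq344PolymerRatio` (p25): `num344`, `Etilde`, `eq346` (abstract (3.46) under footprint-local
incompatibility), `E0`, `supports347`, `eq347` (abstract (3.47)), `exists_subset_of_mem_supports347`, `E0_filter_support`,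
`norm_E0_le` (the abstract (2.42)-type bound); `…B13Resummation` (`locE`, `norm_locE_le`, `kp_condition`);
`…TreeLengthTorus` (`TPt`, `TAdj`, `TStepIn`, `TLinked`, `TFaceConnected`, `IsTDom`, `TDom`, `tsys`, `torusTreeLen`,
`sum_exp_torusTreeLen_le`); `…TreeLengthTorusGeometry` (`TTouch`, `ttouch_refl`, `ttouch_symm`, `treach`, `mem_treach`,
`tloc_of_touch`, `card_treach_le`, `tgeometry`, `ineq227_tcubes`, `torusTreeLen_biUnion_add_two_le`);
`Literature.Probability.LatticeModels.ClusterExpansion` (`IsKPVolume`, `IsPolymerCluster`, `truncatedWeight_eq_zero_of_kp`,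
`kp_hypothesis_of_fintype`, `isKPVolume_of_tsum_le`).

WHAT THIS FILE PROVES (0 `sorry`, 0 `def`, standard axioms; the marked domains and the touching supports are written as
literal filters, so no new definition is introduced; §0 = private chain ∕ counting helpers).
* §1 `ttouch_iff_exists_mem`, `ttouch_of_mem_of_mem` (footprint form of the torus incompatibility; the marked domains ∋ a
  cube form a clique), **`eq346_torus`**, **`eq347_torus`**, `mem_of_mem_tsupports347` — (3.44)–(3.47) on the torus by the
  abstract theorems.
* §2 the torus geometry of the bound: `tFaceConnected_union_touching` + **`torusTreeLen_union_touching_le`** (tree-length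
  subadditivity over the supports touching Z₀, joining cost 2, from pv22's (2.27)-sharpened `torusTreeLen_biUnion_add_two_le`),
  `isTDom_biUnion_of_isPolymerCluster` (the support of a cluster is a torus localization domain), `locE_eq_zero_of_not_isTDom`
  (Kotecký–Preiss: `Ẽ(Λ, Y) = 0` off the localization domains), `sum_exp_isTDom_touching_le` and `sum_exp_marked_le`
  ((1.26)-summability of the touching supports and of the marked domains), `card_le_torusVol` (volume bound).
* §3 **`norm_E0_torus_le`**, `norm_locE_torus_le`, **`norm_E0_torus_le_of_decay`** — the (2.42)-type bound on the (3.47) terms ON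
  THE TORUS under the Kotecký–Preiss hypothesis, then from activity decay with explicit rate ∕ smallness conditions (the
  twins of p25's `norm_E0_window_le…`).
* §4 the `…B14.Eq347Letters` chain on the torus: `isKPVolume_torus_of_decay` ∕ `_of_decayLetters` (KP DISCHARGED from the
  letters), **`norm_E0_torus_le_of_letters`**, **`norm_E0_torus_le_rate`** (same dimension-only thresholds as the window:
  `R ≥ κ + 3κ₀ + 2`, `R′ ≥ κ + κ₀ + 1`, `A·2(4·2^d)²K₀³(2d+1)²e^{7κ+5κ₀+1} ≤ 1` ⇒ `‖𝐄₀(X, c)‖ ≤ (e·K₀)·A′·e^{−κ d(X)}`),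
  `norm_E0_torus_le_target`, `norm_E0_torus_le_improved` (the `Step.LFHypImproved.boundE∕boundR∕boundB` SHAPE at rate (1+4β)κ).

HONEST SCOPE.  (1) Pure instantiation + torus geometry; the letters, the KP-free bound's thresholds and the shape
corollaries are those of `…B14.Eq347Letters`, now on the printed carrier.  (2) `torusTreeLen` vs print's d_j: pv22's
reading (D-pv22g2.1).  (3) The t-dependence of p. 278 and the identification of the activities with Bałaban's fluctuation
integrals (3.37)–(3.43) are not typed (NODE 00).

## References
* [Balaban1988Convergent] T. Bałaban, Commun. Math. Phys. **119** (1988) 243–285: (3.44)–(3.47) pp. 277–278, (2.42) p. 261, p. 262.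
* [Balaban1987RG1] T. Bałaban, Commun. Math. Phys. **109** (1987) 249–301: p. 251 (the torus), p. 257 (localization domains, d_j).
* [Balaban1988RG2Cluster] T. Bałaban, Commun. Math. Phys. **116** (1988) 1–22: (1.26) p. 8, (2.11)–(2.13) p. 14, (2.27) p. 18, p. 20.
* [KoteckyPreiss1986] R. Kotecký, D. Preiss, Commun. Math. Phys. **103** (1986) 491–498: (1), Theorem p. 492.
-/

open scoped BigOperators

namespace Literature.MathematicalPhysics.QuantumFieldTheory.Balaban1983to89.B14.Eq347Torus

open Finset
open Literature.Probability.LatticeModels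
open Literature.MathematicalPhysics.QuantumFieldTheory.Balaban1983to89
open Literature.MathematicalPhysics.QuantumFieldTheory.Balaban1983to89.TreeLengthTorus (TPt TAdj TStepIn TLinked TFaceConnected IsTDom TDom tsys torusTreeLen torusTreeLen_nonneg
  sum_exp_torusTreeLen_le)
open Literature.MathematicalPhysics.QuantumFieldTheory.Balaban1983to89.TreeLengthTorusGeometry (TTouch ttouch_refl ttouch_symm treach mem_treach tloc_of_touch card_treach_le tgeometry
  ineq227_tcubes torusTreeLen_biUnion_add_two_le)
open Literature.MathematicalPhysics.QuantumFieldTheory.Balaban1983to89.B12TreeDecay (kappa₀ K₀ K₀_pos kappa₀_nonneg)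
open Literature.MathematicalPhysics.QuantumFieldTheory.Balaban1983to89.B13Resummation (locE)
open Literature.MathematicalPhysics.QuantumFieldTheory.Balaban1983to89.B14Eq344PolymerRatio (num344 Etilde E0 supports347 eq346 eq347 exists_subset_of_mem_supports347 E0_filter_support
  norm_E0_le)

variable {d N : ℕ}

/-! ## §0  Chains of torus cubes and a counting lemma (no periodicity hypothesis needed) -/

/-- Chains inside a family are chains inside any larger family. [folklore] -/
private theorem tlinked_mono {S S' : Finset (TPt d N)} (h : S ⊆ S') {x y : TPt d N} (hl : TLinked S x y) :
    TLinked S' x y := by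
  unfold TLinked at *
  induction hl with
  | refl => exact Relation.ReflTransGen.refl
  | tail _ hbc ih => exact Relation.ReflTransGen.tail ih ⟨h hbc.1, h hbc.2.1, hbc.2.2⟩

/-- Chains reverse (torus walls are symmetric). [folklore] -/
private theorem tlinked_symm {S : Finset (TPt d N)} {x y : TPt d N} (hl : TLinked S x y) : TLinked S y x := by
  unfold TLinked at *
  induction hl with
  | refl => exact Relation.ReflTransGen.refl
  | tail _ hbc ih => exact Relation.ReflTransGen.head ⟨hbc.2.1, hbc.1, hbc.2.2.symm⟩ ih

/-- Chains concatenate. [folklore] -/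
private theorem tlinked_trans {S : Finset (TPt d N)} {x y z : TPt d N} (h₁ : TLinked S x y) (h₂ : TLinked S y z) :
    TLinked S x z :=
  Relation.ReflTransGen.trans h₁ h₂

/-- One common-wall step is a chain. [folklore] -/
private theorem tlinked_step {S : Finset (TPt d N)} {x y : TPt d N} (h : TStepIn S x y) : TLinked S x y :=
  Relation.ReflTransGen.single h

/-- Counting through a cover: if every `Y ∈ S` contains some `q ∈ Q`, then `Σ_{Y∈S} f(Y) ≤ Σ_{q∈Q} Σ_{Y∈S, q∈Y} f(Y)`
for `f ≥ 0` (as in p25's file, where it is private). [folklore] -/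
private theorem sum_le_sum_sum_filter_of_cover (S : Finset (Finset (TPt d N))) (Q : Finset (TPt d N))
    (f : Finset (TPt d N) → ℝ) (hf : ∀ Y ∈ S, 0 ≤ f Y) (hcov : ∀ Y ∈ S, ∃ q ∈ Q, q ∈ Y) :
    ∑ Y ∈ S, f Y ≤ ∑ q ∈ Q, ∑ Y ∈ S with q ∈ Y, f Y := by
  classical
  calc ∑ Y ∈ S, f Y ≤ ∑ Y ∈ S, ((Q.filter fun q => q ∈ Y).card : ℝ) * f Y := by
        refine Finset.sum_le_sum fun Y hY => ?_
        obtain ⟨q, hq, hr⟩ := hcov Y hY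
        have h1 : (1 : ℝ) ≤ (Q.filter fun q => q ∈ Y).card := by
          exact_mod_cast Finset.card_pos.2 ⟨q, Finset.mem_filter.2 ⟨hq, hr⟩⟩
        nlinarith [hf Y hY]
    _ = ∑ Y ∈ S, ∑ q ∈ Q, if q ∈ Y then f Y else 0 := by
        refine Finset.sum_congr rfl fun Y _ => ?_
        rw [← Finset.sum_filter, Finset.sum_const, nsmul_eq_mul]
    _ = ∑ q ∈ Q, ∑ Y ∈ S, if q ∈ Y then f Y else 0 := Finset.sum_comm
    _ = ∑ q ∈ Q, ∑ Y ∈ S with q ∈ Y, f Y :=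
        Finset.sum_congr rfl fun q _ => by rw [Finset.sum_filter]

variable [NeZero N]

/-! ## §1  (3.44)–(3.47) on the torus

No new definitions are introduced (kernel lane): the marked domains «Z₀ ∋ c» are the filter
`Finset.univ.filter (fun X : TDom d N => c ∈ X.1)` and «`Y` touches `Z₀` along a wall or a cube, on the torus» is the
literal predicate `∃ b ∈ Y, ∃ a ∈ Z₀.1, a = b ∨ TAdj a b` (window versions: `B14Eq344PolymerRatio.domsWith`, `TouchesCells`). -/

/-- The torus incompatibility `TTouch` is footprint-local: `TTouch Z₀ Z ↔` some cube of `Z` is a cube of `Z₀` or shares a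
torus wall with one (wrap-around walls included). [cite: Balaban1988Convergent, (3.46) p.278] -/
theorem ttouch_iff_exists_mem (Z₀ Z : TDom d N) : TTouch Z₀ Z ↔ ∃ b ∈ Z.1, ∃ a ∈ Z₀.1, a = b ∨ TAdj a b := by
  constructor
  · rintro ⟨a, ha, b, hb, h⟩
    exact ⟨b, hb, a, ha, h⟩
  · rintro ⟨b, hb, a, ha, h⟩
    exact ⟨a, ha, b, hb, h⟩

/-- Two torus domains containing the cube `c` are incompatible: the marked domains form a clique, so a compatible family
has at most one of them (`B14Eq344PolymerRatio.card_inter_le_one`). [cite: Balaban1988Convergent, (3.44) p.277] -/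
theorem ttouch_of_mem_of_mem {c : TPt d N} {X X' : TDom d N} (hX : c ∈ X.1) (hX' : c ∈ X'.1) : TTouch X X' :=
  ⟨c, hX, c, hX', Or.inl rfl⟩

open Classical in
/-- **(3.44)–(3.46) ON THE TORUS** (polymers = torus localization domains `TDom d N`, `ζ` of (I.7.11) = `TTouch`,
footprints = the members, `Λ` = all of them, marked domains = those containing the cube `c`): under the Kotecký–Preiss
condition for the denominator activities, `num344 ∕ Ξ = Σ_{Z₀ ∋ c} H′(Z₀) exp[−Σ_{Y touching Z₀} Ẽ(Y)]` with
`Ẽ = B13Resummation.locE TTouch (·.1) H` ((I.7.13)); p25's ABSTRACT `eq346` BY NAME. [cite: Balaban1988Convergent, (3.46) p.278] -/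
theorem eq346_torus {H : TDom d N → ℂ} {a : TDom d N → ℝ} (hKP : IsKPVolume TTouch H a Finset.univ)
    (H' : TDom d N → ℂ) (c : TPt d N) :
    num344 TTouch H' H Finset.univ (Finset.univ.filter fun X : TDom d N => c ∈ X.1) /
        polymerPartitionFunction TTouch H Finset.univ =
      ∑ Z₀ ∈ Finset.univ.filter (fun X : TDom d N => c ∈ X.1), H' Z₀ * Complex.exp
        (-∑ Y ∈ ((Finset.univ : Finset (TDom d N)).powerset.image fun C => C.biUnion fun X => X.1)
            with (∃ b ∈ Y, ∃ a ∈ Z₀.1, a = b ∨ TAdj a b), locE TTouch (fun X : TDom d N => X.1) H Y) := by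
  haveI : Std.Refl (TTouch (d := d) (N := N)) := ⟨ttouch_refl⟩
  haveI : Std.Symm (TTouch (d := d) (N := N)) := ⟨ttouch_symm⟩
  exact eq346 hKP H' (Finset.filter_subset _ _) (fun X : TDom d N => X.1)
    (fun (Z₀ : TDom d N) (b : TPt d N) => ∃ a ∈ Z₀.1, a = b ∨ TAdj a b)
    (fun Z₀ _ Z _ => ttouch_iff_exists_mem Z₀ Z)

/-- On the torus every support `X` of (3.47) contains the marked cube `c` (*«X ⊃ b»*). [cite: Balaban1988Convergent, (3.47) p.278] -/
theorem mem_of_mem_tsupports347 {c : TPt d N} {T : TDom d N → Finset (Finset (TPt d N))} {X : Finset (TPt d N)}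
    [DecidablePred fun X : TDom d N => c ∈ X.1]
    (hX : X ∈ supports347 (Finset.univ.filter fun X : TDom d N => c ∈ X.1) T fun Z : TDom d N => Z.1) : c ∈ X := by
  obtain ⟨Z₀, hZ₀, hsub⟩ := exists_subset_of_mem_supports347 hX
  exact hsub (Finset.mem_filter.1 hZ₀).2

open Classical in
/-- **(3.44)–(3.47) ON THE TORUS**: under the Kotecký–Preiss condition for the denominator activities,
`num344 ∕ Ξ = Σ_{X ∋ c} 𝐄₀(X, c)`, the terms `E0` built from the marked activities `H′`, the Mayer factors `e^{−Ẽ(Y)} − 1`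
over the supports `Y` touching `Z₀`, resummed over `X = Z₀ ∪ ⋃Y` (`eq346_torus` + p25's `eq347`).
[cite: Balaban1988Convergent, (3.47) p.278] -/
theorem eq347_torus {H : TDom d N → ℂ} {a : TDom d N → ℝ} (hKP : IsKPVolume TTouch H a Finset.univ)
    (H' : TDom d N → ℂ) (c : TPt d N) :
    num344 TTouch H' H Finset.univ (Finset.univ.filter fun X : TDom d N => c ∈ X.1) /
        polymerPartitionFunction TTouch H Finset.univ =
      ∑ X ∈ supports347 (Finset.univ.filter fun X : TDom d N => c ∈ X.1)
          (fun Z₀ => ((Finset.univ : Finset (TDom d N)).powerset.image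
            fun C => C.biUnion fun X => X.1).filter (fun Y => ∃ b ∈ Y, ∃ a ∈ Z₀.1, a = b ∨ TAdj a b))
          (fun Z : TDom d N => Z.1),
        E0 (Finset.univ.filter fun X : TDom d N => c ∈ X.1)
          (fun Z₀ => ((Finset.univ : Finset (TDom d N)).powerset.image
            fun C => C.biUnion fun X => X.1).filter (fun Y => ∃ b ∈ Y, ∃ a ∈ Z₀.1, a = b ∨ TAdj a b))
          (fun Z : TDom d N => Z.1) H' (locE TTouch (fun Z : TDom d N => Z.1) H) X := by
  rw [eq346_torus hKP H' c]
  exact eq347 _ _ _ _ _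

/-! ## §2  The torus geometry the bound needs -/

section Geometry

/-- The union of a torus localization domain `Z₀` with torus localization domains each touching `Z₀` along a wall or a
cube is torus-face-connected. [cite: Balaban1987RG1, p.257 (localization domains)] -/
theorem tFaceConnected_union_touching (Z₀ : TDom d N) (𝒴 : Finset (Finset (TPt d N))) (hgood : ∀ Y ∈ 𝒴, IsTDom Y)
    (htouch : ∀ Y ∈ 𝒴, ∃ b ∈ Y, ∃ a ∈ Z₀.1, a = b ∨ TAdj a b) :
    TFaceConnected (Z₀.1 ∪ 𝒴.biUnion id) := by
  classical
  set U : Finset (TPt d N) := Z₀.1 ∪ 𝒴.biUnion id with hU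
  have hZ₀U : Z₀.1 ⊆ U := Finset.subset_union_left
  have hYU : ∀ Y ∈ 𝒴, Y ⊆ U := fun Y hY =>
    (Finset.subset_biUnion_of_mem id hY).trans Finset.subset_union_right
  -- every cube of `U` is linked inside `U` to a cube of `Z₀`
  have key : ∀ x ∈ U, ∃ a ∈ Z₀.1, TLinked U x a := by
    intro x hx
    rcases Finset.mem_union.1 hx with hx | hx
    · exact ⟨x, hx, Relation.ReflTransGen.refl⟩
    · obtain ⟨Y, hY, hxY⟩ := Finset.mem_biUnion.1 hx
      obtain ⟨b, hb, a, ha, hab⟩ := htouch Y hY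
      have hxb : TLinked U x b := tlinked_mono (hYU Y hY) ((hgood Y hY).2 x hxY b hb)
      refine ⟨a, ha, ?_⟩
      rcases hab with hab | hab
      · rw [hab]
        exact hxb
      · exact tlinked_trans hxb (tlinked_step ⟨hYU Y hY hb, hZ₀U ha, hab.symm⟩)
  intro x hx y hy
  obtain ⟨a, ha, hxa⟩ := key x hx
  obtain ⟨a', ha', hya'⟩ := key y hy
  have haa' : TLinked U a a' := tlinked_mono hZ₀U (Z₀.2.2 a ha a' ha')
  exact tlinked_trans hxa (tlinked_trans haa' (tlinked_symm hya'))

/-- **Tree-length subadditivity over the supports touching `Z₀`, ON THE TORUS** ((2.27)/(2.32)-type, joining cost 2): for torus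
localization domains `Y ∈ 𝒴`, each touching `Z₀` along a wall or a cube, `Z₀ ∪ ⋃𝒴` is a torus localization domain and
`d(Z₀ ∪ ⋃𝒴) ≤ d(Z₀) + Σ_{Y∈𝒴} (d(Y) + 2)` — from pv22's sharpened (2.27) `torusTreeLen_biUnion_add_two_le` on the family
`{Z₀} ∪ 𝒴`; window version `B14Eq344PolymerRatio.treeLen_union_touching_le`. [cite: Balaban1988RG2Cluster, (2.27) p.18] -/
theorem torusTreeLen_union_touching_le (Z₀ : TDom d N) (𝒴 : Finset (Finset (TPt d N))) (hgood : ∀ Y ∈ 𝒴, IsTDom Y)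
    (htouch : ∀ Y ∈ 𝒴, ∃ b ∈ Y, ∃ a ∈ Z₀.1, a = b ∨ TAdj a b) :
    TFaceConnected (Z₀.1 ∪ 𝒴.biUnion id) ∧
      torusTreeLen (Z₀.1 ∪ 𝒴.biUnion id) ≤ torusTreeLen Z₀.1 + ∑ Y ∈ 𝒴, (torusTreeLen Y + 2) := by
  classical
  have hU := tFaceConnected_union_touching Z₀ 𝒴 hgood htouch
  refine ⟨hU, ?_⟩
  have hDeq : (insert Z₀.1 𝒴).biUnion id = Z₀.1 ∪ 𝒴.biUnion id := Finset.biUnion_insert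
  have hmem : ∀ Y ∈ insert Z₀.1 𝒴, Y.Nonempty ∧ TFaceConnected Y := by
    intro Y hY
    rcases Finset.mem_insert.1 hY with h | h
    · rw [h]
      exact Z₀.2
    · exact hgood Y h
  have h := torusTreeLen_biUnion_add_two_le (Finset.insert_nonempty Z₀.1 𝒴) hmem (hDeq ▸ hU)
  rw [hDeq] at h
  have hsum : ∑ Y ∈ insert Z₀.1 𝒴, (torusTreeLen Y + 2) ≤
      (torusTreeLen Z₀.1 + 2) + ∑ Y ∈ 𝒴, (torusTreeLen Y + 2) := by
    by_cases h0 : Z₀.1 ∈ 𝒴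
    · rw [Finset.insert_eq_of_mem h0]
      linarith [torusTreeLen_nonneg Z₀.1]
    · rw [Finset.sum_insert h0]
  linarith

/-- **The support of a cluster is a torus localization domain**: the union of the footprints of a non-empty family of
torus domains which is a cluster for `TTouch` (not decomposable into two mutually non-touching parts) is non-empty and
torus-face-connected; window version `B14Eq344PolymerRatio.good_biUnion_of_isPolymerCluster`. [cite: Balaban1988RG2Cluster, (2.13) p.14] -/
theorem isTDom_biUnion_of_isPolymerCluster [DecidableEq (TDom d N)] {C : Finset (TDom d N)} (hC : IsPolymerCluster TTouch C)
    (hne : C.Nonempty) : IsTDom (C.biUnion fun Z : TDom d N => Z.1) := by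
  classical
  set U : Finset (TPt d N) := C.biUnion fun Z : TDom d N => Z.1 with hU
  have hZU : ∀ Z ∈ C, (Z : TDom d N).1 ⊆ U := fun Z hZ x hx => Finset.mem_biUnion.2 ⟨Z, hZ, hx⟩
  obtain ⟨Z₁, hZ₁⟩ := hne
  obtain ⟨x₁, hx₁⟩ := Z₁.2.1
  refine ⟨⟨x₁, hZU Z₁ hZ₁ hx₁⟩, ?_⟩
  -- every cube of `U` is linked inside `U` to `x₁`
  suffices key : ∀ Z ∈ C, ∀ y ∈ (Z : TDom d N).1, TLinked U x₁ y by
    intro x hx y hy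
    obtain ⟨Zx, hZx, hxZ⟩ := Finset.mem_biUnion.1 hx
    obtain ⟨Zy, hZy, hyZ⟩ := Finset.mem_biUnion.1 hy
    exact tlinked_trans (tlinked_symm (key Zx hZx x hxZ)) (key Zy hZy y hyZ)
  -- the sub-family of domains all of whose cubes are linked to `x₁` is all of `C` (cluster property)
  set C₁ := C.filter fun Z => ∀ y ∈ (Z : TDom d N).1, TLinked U x₁ y with hC₁
  have hspread : ∀ Z ∈ C, ∀ y₀ ∈ (Z : TDom d N).1, TLinked U x₁ y₀ → ∀ y ∈ Z.1, TLinked U x₁ y :=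
    fun Z hZ y₀ hy₀ h y hy => tlinked_trans h (tlinked_mono (hZU Z hZ) (Z.2.2 y₀ hy₀ y hy))
  have hZ₁C₁ : Z₁ ∈ C₁ :=
    Finset.mem_filter.2 ⟨hZ₁, hspread Z₁ hZ₁ x₁ hx₁ Relation.ReflTransGen.refl⟩
  by_contra hnot
  have hdiff : (C \ C₁).Nonempty := by
    by_contra hempty
    apply hnot
    intro Z hZ y hy
    have hZC₁ : Z ∈ C₁ := by
      by_contra hZC₁
      exact hempty ⟨Z, Finset.mem_sdiff.2 ⟨hZ, hZC₁⟩⟩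
    exact (Finset.mem_filter.1 hZC₁).2 y hy
  obtain ⟨W₁, hW₁, W₂, hW₂, hW⟩ := hC C₁ (Finset.filter_subset _ _) ⟨Z₁, hZ₁C₁⟩ hdiff
  obtain ⟨a, ha, b, hb, hab⟩ := hW
  obtain ⟨hW₁C, hW₁l⟩ := Finset.mem_filter.1 hW₁
  obtain ⟨hW₂C, hW₂n⟩ := Finset.mem_sdiff.1 hW₂
  have ha1 : TLinked U x₁ a := hW₁l a ha
  have hb1 : TLinked U x₁ b := by
    rcases hab with hab | hab
    · rw [← hab]
      exact ha1
    · exact tlinked_trans ha1 (tlinked_step ⟨hZU W₁ hW₁C ha, hZU W₂ hW₂C hb, hab⟩)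
  exact hW₂n (Finset.mem_filter.2 ⟨hW₂C, hspread W₂ hW₂C b hb hb1⟩)

open Classical in
/-- **`Ẽ(Λ, Y) = 0` off the torus localization domains** (Kotecký–Preiss): under the KP condition the truncated functional
vanishes on non-clusters (`truncatedWeight_eq_zero_of_kp`), and the support of a cluster is a torus localization domain
(`isTDom_biUnion_of_isPolymerCluster`); so `locE … Y = 0` for every non-empty `Y` that is not one; window version
`B14Eq344PolymerRatio.locE_eq_zero_of_not_good`. [cite: Balaban1988Convergent, (3.46) p.278] -/
theorem locE_eq_zero_of_not_isTDom {H : TDom d N → ℂ} {a : TDom d N → ℝ} (hKP : IsKPVolume TTouch H a Finset.univ)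
    {Y : Finset (TPt d N)} (hYne : Y.Nonempty) (hY : ¬ IsTDom Y) :
    locE TTouch (fun Z : TDom d N => Z.1) H Y = 0 := by
  haveI : Std.Refl (TTouch (d := d) (N := N)) := ⟨ttouch_refl⟩
  haveI : Std.Symm (TTouch (d := d) (N := N)) := ⟨ttouch_symm⟩
  refine Finset.sum_eq_zero fun C hC => ?_
  obtain ⟨-, hCY⟩ := B13FamilySum.mem_coveringFamilies.1 hC
  refine truncatedWeight_eq_zero_of_kp hKP (Finset.subset_univ C) fun hcl => hY ?_
  have hCne : C.Nonempty := by
    rw [Finset.nonempty_iff_ne_empty]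
    rintro rfl
    rw [Finset.biUnion_empty] at hCY
    exact hYne.ne_empty hCY.symm
  rw [← hCY]
  exact isTDom_biUnion_of_isPolymerCluster hcl hCne

/-- **(1.26)-summability of the torus localization domains touching `Z₀`**: for `κ′ ≥ κ₀(4·2^d, 2d)`, the sum of `e^{−κ′ d(Y)}`
over any family of distinct torus localization domains `Y` touching `Z₀` is `≤ (2d+1) K₀ · #Z₀` (each such `Y` contains a
cube of the reach of `Z₀`; `TreeLengthTorus.sum_exp_torusTreeLen_le` per cube; `card_treach_le`); window version
`B14Eq344PolymerRatio.sum_exp_good_touching_le`. [cite: Balaban1988RG2Cluster, (1.26) p.8] -/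
theorem sum_exp_isTDom_touching_le (Z₀ : TDom d N) (S : Finset (Finset (TPt d N))) (hgood : ∀ Y ∈ S, IsTDom Y)
    (htouch : ∀ Y ∈ S, ∃ b ∈ Y, ∃ a ∈ Z₀.1, a = b ∨ TAdj a b) {κ' : ℝ}
    (hκ' : kappa₀ (4 * 2 ^ d) (2 * d) ≤ κ') :
    ∑ Y ∈ S, Real.exp (-(κ' * torusTreeLen Y)) ≤ (2 * (d : ℝ) + 1) * K₀ (4 * 2 ^ d) (2 * d) * (Z₀.1.card : ℝ) := by
  classical
  have hcov : ∀ Y ∈ S, ∃ q ∈ treach Z₀, q ∈ Y := by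
    intro Y hY
    obtain ⟨b, hb, a, ha, hab⟩ := htouch Y hY
    refine ⟨b, mem_treach.2 ⟨a, ha, ?_⟩, hb⟩
    rcases hab with hab | hab
    · exact Or.inl hab.symm
    · exact Or.inr hab
  refine (sum_le_sum_sum_filter_of_cover S (treach Z₀) _ (fun Y _ => Real.exp_nonneg _) hcov).trans ?_
  have hq : ∀ q ∈ treach Z₀, ∑ Y ∈ S with q ∈ Y, Real.exp (-(κ' * torusTreeLen Y)) ≤ K₀ (4 * 2 ^ d) (2 * d) := by
    intro q _
    calc ∑ Y ∈ S with q ∈ Y, Real.exp (-(κ' * torusTreeLen Y))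
        = ∑ Y ∈ S with q ∈ Y, Real.exp (-κ' * torusTreeLen Y) :=
          Finset.sum_congr rfl fun Y _ => by rw [neg_mul]
      _ ≤ ∑ X ∈ (Finset.univ : Finset (Finset (TPt d N))).filter (fun X => q ∈ X ∧ TFaceConnected X),
            Real.exp (-κ' * torusTreeLen X) := by
          refine Finset.sum_le_sum_of_subset_of_nonneg (fun Y hY => ?_) fun _ _ _ => Real.exp_nonneg _
          obtain ⟨hYS, hqY⟩ := Finset.mem_filter.1 hY
          exact Finset.mem_filter.2 ⟨Finset.mem_univ _, hqY, (hgood Y hYS).2⟩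
      _ ≤ K₀ (4 * 2 ^ d) (2 * d) := sum_exp_torusTreeLen_le d N q hκ'
  calc ∑ q ∈ treach Z₀, ∑ Y ∈ S with q ∈ Y, Real.exp (-(κ' * torusTreeLen Y))
      ≤ ∑ q ∈ treach Z₀, K₀ (4 * 2 ^ d) (2 * d) := Finset.sum_le_sum hq
    _ = ((treach Z₀).card : ℝ) * K₀ (4 * 2 ^ d) (2 * d) := by rw [Finset.sum_const, nsmul_eq_mul]
    _ ≤ (2 * (d : ℝ) + 1) * (Z₀.1.card : ℝ) * K₀ (4 * 2 ^ d) (2 * d) :=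
        mul_le_mul_of_nonneg_right (card_treach_le Z₀) (K₀_pos _ _).le
    _ = (2 * (d : ℝ) + 1) * K₀ (4 * 2 ^ d) (2 * d) * (Z₀.1.card : ℝ) := by ring

/-- **(1.26) for the marked torus domains**: `Σ_{Z₀ ∋ c} e^{−κ₂ d(Z₀)} ≤ K₀(4·2^d, 2d)` for `κ₂ ≥ κ₀(4·2^d, 2d)`
(`TreeLengthTorus.sum_exp_torusTreeLen_le`); window version `B14Eq344PolymerRatio.sum_exp_domsWith_le`.
[cite: Balaban1988RG2Cluster, (1.26) p.8] -/
theorem sum_exp_marked_le (c : TPt d N) {κ₂ : ℝ} (hκ₂ : kappa₀ (4 * 2 ^ d) (2 * d) ≤ κ₂)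
    [DecidablePred fun X : TDom d N => c ∈ X.1] :
    ∑ Z₀ ∈ Finset.univ.filter (fun X : TDom d N => c ∈ X.1), Real.exp (-(κ₂ * torusTreeLen Z₀.1)) ≤
      K₀ (4 * 2 ^ d) (2 * d) := by
  classical
  have hinj : ∀ Z ∈ Finset.univ.filter (fun X : TDom d N => c ∈ X.1),
      ∀ Z' ∈ Finset.univ.filter (fun X : TDom d N => c ∈ X.1), (Z : TDom d N).1 = Z'.1 → Z = Z' :=
    fun Z _ Z' _ h => Subtype.ext h
  calc ∑ Z₀ ∈ Finset.univ.filter (fun X : TDom d N => c ∈ X.1), Real.exp (-(κ₂ * torusTreeLen Z₀.1))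
      = ∑ X ∈ (Finset.univ.filter (fun X : TDom d N => c ∈ X.1)).image (fun Z : TDom d N => Z.1),
          Real.exp (-κ₂ * torusTreeLen X) := by
        rw [Finset.sum_image hinj]
        exact Finset.sum_congr rfl fun Z _ => by rw [neg_mul]
    _ ≤ ∑ X ∈ (Finset.univ : Finset (Finset (TPt d N))).filter (fun X => c ∈ X ∧ TFaceConnected X),
          Real.exp (-κ₂ * torusTreeLen X) := by
        refine Finset.sum_le_sum_of_subset_of_nonneg (fun X hX => ?_) fun _ _ _ => Real.exp_nonneg _
        obtain ⟨Z, hZ, rfl⟩ := Finset.mem_image.1 hX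
        exact Finset.mem_filter.2 ⟨Finset.mem_univ _, (Finset.mem_filter.1 hZ).2, Z.2.2⟩
    _ ≤ K₀ (4 * 2 ^ d) (2 * d) := sum_exp_torusTreeLen_le d N c hκ₂

/-- **The volume bound (2.30) on the torus**: `#Z₀ ≤ 4·2^d (1 + d(Z₀))` (`TreeLengthTorusGeometry.tgeometry.volBound`).
[cite: Balaban1988RG2Cluster, (2.30) p.18] -/
theorem card_le_torusVol (Z₀ : TDom d N) : (Z₀.1.card : ℝ) ≤ 4 * 2 ^ d * (1 + torusTreeLen Z₀.1) :=
  (tgeometry d N).volBound Z₀ (Finset.mem_univ _)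

end Geometry

/-! ## §3  The (2.42)-type bound on the (3.47) terms ON THE TORUS -/

section Bound

open Classical in
/-- **THE (2.42)-TYPE BOUND ON THE (3.47) TERMS ON THE TORUS** (p. 278 *«The terms of the sum above satisfy the bounds
(2.42)»*), p25's abstract kernel theorem `norm_E0_le` with its geometric inputs discharged ON THE PERIODIC CARRIER: for the
polymer gas of the torus (domains `TDom d N`, incompatibility `TTouch`, footprints = members, size = `torusTreeLen`) under the
Kotecký–Preiss condition for the denominator activities `H`, IF the marked activities decay, `‖H′(Z₀)‖ ≤ A′e^{−R d(Z₀)}`, and the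
exponents are small with decay on the localization domains, `‖Ẽ(Y)‖ ≤ ε e^{−r d(Y)}` (`Ẽ = B13Resummation.locE`), with `ε ≤ 1`,
`r − κ ≥ κ₀(4·2^d,2d)`, `κ₂ ≥ κ₀(4·2^d,2d)` and `κ + 2εe^{2κ}(2d+1)K₀·4·2^d + κ₂ ≤ R`, THEN the terms of `eq347_torus` obey
`‖𝐄₀(X, c)‖ ≤ A′ e^{2εe^{2κ}(2d+1)K₀·4·2^d} K₀ · e^{−κ d(X)}`; window version `B14Eq344PolymerRatio.norm_E0_window_le`.
[cite: Balaban1988Convergent, (3.47) p.278] -/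
theorem norm_E0_torus_le {H H' : TDom d N → ℂ} {a : TDom d N → ℝ} (hKP : IsKPVolume TTouch H a Finset.univ)
    (c : TPt d N) {A' R ε r κ κ₂ : ℝ} (hA' : 0 ≤ A') (hε : 0 ≤ ε) (hε1 : ε ≤ 1) (hκ : 0 ≤ κ) (hr : 0 ≤ r)
    (hrκ : kappa₀ (4 * 2 ^ d) (2 * d) ≤ r - κ) (hκ₂ : kappa₀ (4 * 2 ^ d) (2 * d) ≤ κ₂)
    (hH' : ∀ Z₀ : TDom d N, ‖H' Z₀‖ ≤ A' * Real.exp (-(R * torusTreeLen Z₀.1)))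
    (hE : ∀ Y : Finset (TPt d N), IsTDom Y →
      ‖locE TTouch (fun Z : TDom d N => Z.1) H Y‖ ≤ ε * Real.exp (-(r * torusTreeLen Y)))
    (hrate : κ + 2 * ε * Real.exp (κ * 2) * ((2 * (d : ℝ) + 1) * K₀ (4 * 2 ^ d) (2 * d)) * (4 * 2 ^ d) + κ₂ ≤ R)
    (X : Finset (TPt d N)) :
    ‖E0 (Finset.univ.filter fun Z : TDom d N => c ∈ Z.1)
        (fun Z₀ => ((Finset.univ : Finset (TDom d N)).powerset.image
          fun C => C.biUnion fun X => X.1).filter (fun Y => ∃ b ∈ Y, ∃ a ∈ Z₀.1, a = b ∨ TAdj a b))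
        (fun Z : TDom d N => Z.1) H' (locE TTouch (fun Z : TDom d N => Z.1) H) X‖ ≤
      A' * Real.exp (2 * ε * Real.exp (κ * 2) * ((2 * (d : ℝ) + 1) * K₀ (4 * 2 ^ d) (2 * d)) * (4 * 2 ^ d)) *
        K₀ (4 * 2 ^ d) (2 * d) * Real.exp (-(κ * torusTreeLen X)) := by
  have hTne : ∀ Z₀ : TDom d N, ∀ Y ∈ ((Finset.univ : Finset (TDom d N)).powerset.image
      fun C => C.biUnion fun X => X.1).filter (fun Y => ∃ b ∈ Y, ∃ a ∈ Z₀.1, a = b ∨ TAdj a b), Y.Nonempty := by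
    intro Z₀ Y hY
    obtain ⟨b, hb, -⟩ := (Finset.mem_filter.1 hY).2
    exact ⟨b, hb⟩
  rw [E0_filter_support (p := IsTDom) _ _ _ _ _
    (hp := fun Z₀ _ Y hY hng => locE_eq_zero_of_not_isTDom hKP (hTne Z₀ Y hY) hng)]
  have hK : 0 ≤ (2 * (d : ℝ) + 1) * K₀ (4 * 2 ^ d) (2 * d) := mul_nonneg (by positivity) (K₀_pos _ _).le
  refine norm_E0_le (R := R) (r := r) (κ₂ := κ₂) (Finset.univ.filter fun Z : TDom d N => c ∈ Z.1) _
    (fun Z : TDom d N => Z.1) H' _ torusTreeLen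
    (fun Y => torusTreeLen_nonneg _) hκ hε hε1 hr hK (by positivity) hA' ?_ ?_ ?_ ?_ ?_ ?_ hrate X
  · -- subadditivity over the touching localization domains
    intro Z₀ _ 𝒴 h𝒴
    have hgood : ∀ Y ∈ 𝒴, IsTDom Y := fun Y hY => (Finset.mem_filter.1 (h𝒴 hY)).2
    have htouch : ∀ Y ∈ 𝒴, ∃ b ∈ Y, ∃ a ∈ Z₀.1, a = b ∨ TAdj a b := fun Y hY =>
      (Finset.mem_filter.1 (Finset.mem_filter.1 (h𝒴 hY)).1).2
    exact (torusTreeLen_union_touching_le Z₀ 𝒴 hgood htouch).2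
  · intro Z₀ _ Y hY
    exact hE Y (Finset.mem_filter.1 hY).2
  · intro Z₀ _
    exact sum_exp_isTDom_touching_le Z₀ _ (fun Y hY => (Finset.mem_filter.1 hY).2)
      (fun Y hY => (Finset.mem_filter.1 (Finset.mem_filter.1 hY).1).2) hrκ
  · intro Z₀ _
    exact hH' Z₀
  · intro Z₀ _
    exact card_le_torusVol Z₀
  · exact sum_exp_marked_le c hκ₂

open Classical in
/-- **The exponents `Ẽ(Y)` on the torus localization domains are small with tree decay** when the activities `H` decay —
`B13Resummation.norm_locE_le` ([Balaban1988RG2Cluster] (2.13)–(2.29), Kotecký–Preiss + (1.26) + (2.27) + (2.30)) with every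
geometric hypothesis discharged by `TreeLengthTorusGeometry.tgeometry` ∕ `ineq227_tcubes`: for `‖H(Z)‖ ≤ A e^{−R d(Z)}`,
`R ≥ r₁ + 2κ₀ + 1 + 4·2^d τ`, `A e^{b + 4·2^d τ} K₀ (2d+1) ≤ τ`, `b ≥ 5r₁`, `‖Ẽ(Y)‖ ≤ τ·4·2^d·K₀·e^{−b}·e^{−r₁ d(Y)}` on every
torus localization domain `Y`; window version `B14Eq344PolymerRatio.norm_locE_window_le`. [cite: Balaban1988Convergent, (3.46) p.278] -/
theorem norm_locE_torus_le {H : TDom d N → ℂ} {A R r₁ b τ : ℝ} (hA : 0 ≤ A) (hτ : 0 ≤ τ) (hr₁ : 0 ≤ r₁)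
    (hb : r₁ * 5 ≤ b) (hH : ∀ Z : TDom d N, ‖H Z‖ ≤ A * Real.exp (-(R * torusTreeLen Z.1)))
    (hrate : r₁ + 2 * kappa₀ (4 * 2 ^ d) (2 * d) + 1 + τ * (4 * 2 ^ d) ≤ R)
    (hsmall : A * Real.exp (b + τ * (4 * 2 ^ d)) * K₀ (4 * 2 ^ d) (2 * d) * (2 * (d : ℝ) + 1) ≤ τ)
    {Y : Finset (TPt d N)} (hY : IsTDom Y) :
    ‖locE TTouch (fun Z : TDom d N => Z.1) H Y‖ ≤
      τ * (4 * 2 ^ d) * K₀ (4 * 2 ^ d) (2 * d) * Real.exp (-b) * Real.exp (-(r₁ * torusTreeLen Y)) := by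
  haveI : Std.Refl (TTouch (d := d) (N := N)) := ⟨ttouch_refl⟩
  haveI : Std.Symm (TTouch (d := d) (N := N)) := ⟨ttouch_symm⟩
  have h227 := ineq227_tcubes d N ⟨Y, hY⟩
  exact B13Resummation.norm_locE_le TTouch (reach := treach) (d := fun Z : TDom d N => torusTreeLen Z.1)
    (fun Z Z' h => tloc_of_touch h) card_treach_le (fun Z => torusTreeLen_nonneg _) hA (K₀_pos _ _).le
    (by positivity) hτ (kappa₀_nonneg (by positivity) _) hr₁ (by norm_num) hb (fun Z _ => hH Z)
    (tgeometry d N).ineq126 (tgeometry d N).volBound h227 hrate hsmall hY.1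

open Classical in
/-- **The (2.42)-type bound on the (3.47) terms ON THE TORUS from activity decay** (`norm_E0_torus_le` ∘ `norm_locE_torus_le`):
under the Kotecký–Preiss condition, if `‖H(Z)‖ ≤ A e^{−R d(Z)}` and `‖H′(Z₀)‖ ≤ A′e^{−R′d(Z₀)}` with the rate and smallness
conditions listed (κ₀ = κ₀(4·2^d,2d), K₀ = K₀(4·2^d,2d), c₁ = 4·2^d, ν = 2d+1, joining costs 5 and 2), then
`‖𝐄₀(X, c)‖ ≤ A′ e^{2εe^{2κ}(2d+1)K₀c₁} K₀ e^{−κ d(X)}` with `ε = τ c₁ K₀ e^{−b}`; window version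
`B14Eq344PolymerRatio.norm_E0_window_le_of_decay`. [cite: Balaban1988Convergent, (3.47) p.278] -/
theorem norm_E0_torus_le_of_decay {H H' : TDom d N → ℂ} {a : TDom d N → ℝ} (hKP : IsKPVolume TTouch H a Finset.univ)
    (c : TPt d N) {A A' R R' r₁ b τ κ κ₂ : ℝ} (hA : 0 ≤ A) (hA' : 0 ≤ A') (hτ : 0 ≤ τ) (hr₁ : 0 ≤ r₁)
    (hb : r₁ * 5 ≤ b) (hκ : 0 ≤ κ)
    (hH : ∀ Z : TDom d N, ‖H Z‖ ≤ A * Real.exp (-(R * torusTreeLen Z.1)))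
    (hH' : ∀ Z₀ : TDom d N, ‖H' Z₀‖ ≤ A' * Real.exp (-(R' * torusTreeLen Z₀.1)))
    (hrate : r₁ + 2 * kappa₀ (4 * 2 ^ d) (2 * d) + 1 + τ * (4 * 2 ^ d) ≤ R)
    (hsmall : A * Real.exp (b + τ * (4 * 2 ^ d)) * K₀ (4 * 2 ^ d) (2 * d) * (2 * (d : ℝ) + 1) ≤ τ)
    (hε1 : τ * (4 * 2 ^ d) * K₀ (4 * 2 ^ d) (2 * d) * Real.exp (-b) ≤ 1)
    (hrκ : kappa₀ (4 * 2 ^ d) (2 * d) ≤ r₁ - κ) (hκ₂ : kappa₀ (4 * 2 ^ d) (2 * d) ≤ κ₂)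
    (hrate' : κ + 2 * (τ * (4 * 2 ^ d) * K₀ (4 * 2 ^ d) (2 * d) * Real.exp (-b)) * Real.exp (κ * 2) *
        ((2 * (d : ℝ) + 1) * K₀ (4 * 2 ^ d) (2 * d)) * (4 * 2 ^ d) + κ₂ ≤ R')
    (X : Finset (TPt d N)) :
    ‖E0 (Finset.univ.filter fun Z : TDom d N => c ∈ Z.1)
        (fun Z₀ => ((Finset.univ : Finset (TDom d N)).powerset.image
          fun C => C.biUnion fun X => X.1).filter (fun Y => ∃ b ∈ Y, ∃ a ∈ Z₀.1, a = b ∨ TAdj a b))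
        (fun Z : TDom d N => Z.1) H' (locE TTouch (fun Z : TDom d N => Z.1) H) X‖ ≤
      A' * Real.exp (2 * (τ * (4 * 2 ^ d) * K₀ (4 * 2 ^ d) (2 * d) * Real.exp (-b)) * Real.exp (κ * 2) *
          ((2 * (d : ℝ) + 1) * K₀ (4 * 2 ^ d) (2 * d)) * (4 * 2 ^ d)) *
        K₀ (4 * 2 ^ d) (2 * d) * Real.exp (-(κ * torusTreeLen X)) :=
  norm_E0_torus_le hKP c hA'
    (mul_nonneg (mul_nonneg (mul_nonneg hτ (by positivity)) (K₀_pos _ _).le) (Real.exp_nonneg _)) hε1 hκ hr₁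
    hrκ hκ₂ hH' (fun _ hY => norm_locE_torus_le hA hτ hr₁ hb hH hrate hsmall hY) hrate' X

end Bound

/-! ## §4  The `…B14.Eq347Letters` chain on the torus: KP discharged, letters only, thresholds, the improved shape -/

section Letters

open Classical in
/-- **The Kotecký–Preiss condition for the torus polymer gas from activity decay** ([Balaban1988RG2Cluster] p. 20:
*«The above lemma implies that sufficient conditions for convergence of the series (2.12), (2.13) are satisfied»*; used on
p. 278 of [Balaban1988Convergent]: *«The sum is exponentiated»*): if `‖H Z‖ ≤ A e^{−R d(Z)}` on the localization domains of
the torus (`d` = torus tree length), `R ≥ κ₀ + 4·2^d·τ` and `A e^{4·2^d τ} K₀ (2d+1) ≤ τ` (κ₀ = κ₀(4·2^d, 2d), K₀ = K₀(4·2^d, 2d)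
of (1.26)), then [KoteckyPreiss1986] (1) holds on the whole gas with the size function `a(Z) = τ·#cells Z`:
`Σ_{Z′ touching Z} ‖H Z′‖ e^{a(Z′)} ≤ a(Z)`. [cite: Balaban1988RG2Cluster, p.20 (after (2.38))] -/
theorem isKPVolume_torus_of_decay {H : TDom d N → ℂ} {A R τ : ℝ} (hA : 0 ≤ A) (hτ : 0 ≤ τ)
    (hH : ∀ Z : TDom d N, ‖H Z‖ ≤ A * Real.exp (-(R * torusTreeLen Z.1)))
    (hrate : kappa₀ (4 * 2 ^ d) (2 * d) + τ * (4 * 2 ^ d) ≤ R)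
    (hsmall : A * Real.exp (τ * (4 * 2 ^ d)) * K₀ (4 * 2 ^ d) (2 * d) * (2 * (d : ℝ) + 1) ≤ τ) :
    IsKPVolume TTouch H (fun Z : TDom d N => τ * (Z.1.card : ℝ)) (Finset.univ : Finset (TDom d N)) := by
  classical
  have hkp := B13Resummation.kp_condition TTouch (cubes := fun Z : TDom d N => Z.1) (reach := treach)
    (d := fun Z : TDom d N => torusTreeLen Z.1) (w := H) (s := 0) (b := 0)
    (fun Z Z' h => tloc_of_touch h) card_treach_le (fun Z => torusTreeLen_nonneg _) hA (K₀_pos _ _).le hτ hH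
    (tgeometry d N).ineq126 (tgeometry d N).volBound (by rw [add_zero]; exact hrate) (by rw [zero_add]; exact hsmall)
  have h1 := fun γ => kp_hypothesis_of_fintype (inc := TTouch) (w := H)
    (a := fun Z : TDom d N => τ * (Z.1.card : ℝ)) (d := fun Z : TDom d N => 0 * torusTreeLen Z.1 + 0) hkp γ
  have hdK : ∀ Z : TDom d N, (0 : ℝ) ≤ 0 * torusTreeLen Z.1 + 0 := fun Z => by simp
  exact isKPVolume_of_tsum_le (inc := TTouch) (w := H) (a := fun Z : TDom d N => τ * (Z.1.card : ℝ))
    (d := fun Z : TDom d N => 0 * torusTreeLen Z.1 + 0) hdK h1 Finset.univ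

open Classical in
/-- The same from the rate and smallness letters of `norm_E0_torus_le_of_decay` (which are stronger:
`r₁ + 2κ₀ + 1 + 4·2^d τ ≤ R` with `r₁ ≥ 0`, and `A e^{b + 4·2^d τ} K₀ (2d+1) ≤ τ` with `b ≥ 5r₁ ≥ 0`). [cite: Balaban1988RG2Cluster, p.20 (after (2.38))] -/
theorem isKPVolume_torus_of_decayLetters {H : TDom d N → ℂ} {A R r₁ b τ : ℝ} (hA : 0 ≤ A)
    (hτ : 0 ≤ τ) (hr₁ : 0 ≤ r₁) (hb : r₁ * 5 ≤ b)
    (hH : ∀ Z : TDom d N, ‖H Z‖ ≤ A * Real.exp (-(R * torusTreeLen Z.1)))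
    (hrate : r₁ + 2 * kappa₀ (4 * 2 ^ d) (2 * d) + 1 + τ * (4 * 2 ^ d) ≤ R)
    (hsmall : A * Real.exp (b + τ * (4 * 2 ^ d)) * K₀ (4 * 2 ^ d) (2 * d) * (2 * (d : ℝ) + 1) ≤ τ) :
    IsKPVolume TTouch H (fun Z : TDom d N => τ * (Z.1.card : ℝ)) (Finset.univ : Finset (TDom d N)) := by
  have hκ₀ : 0 ≤ kappa₀ (4 * 2 ^ d) (2 * d) := kappa₀_nonneg (by positivity) _
  have hK : 0 ≤ K₀ (4 * 2 ^ d) (2 * d) := (K₀_pos _ _).le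
  refine isKPVolume_torus_of_decay hA hτ hH (by linarith) (le_trans ?_ hsmall)
  have hb0 : 0 ≤ b := by linarith
  have hexp : Real.exp (τ * (4 * 2 ^ d)) ≤ Real.exp (b + τ * (4 * 2 ^ d)) := Real.exp_le_exp.mpr (by linarith)
  have h2d : (0 : ℝ) ≤ 2 * (d : ℝ) + 1 := by positivity
  exact mul_le_mul_of_nonneg_right (mul_le_mul_of_nonneg_right (mul_le_mul_of_nonneg_left hexp hA) hK) h2d



open Classical in
/-- **(3.47) p. 278 — «The terms of the sum above satisfy the bounds (2.42), with the constant B₀ replaced by O(p₀³(g_k))» —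
FROM THE ACTIVITY LETTERS ALONE, ON THE TORUS**: `norm_E0_torus_le_of_decay` with its Kotecký–Preiss hypothesis
DISCHARGED (window version `B14.Eq347Letters.norm_E0_window_le_of_letters`): if the denominator activities obey `‖H Z‖ ≤ A e^{−R d(Z)}` and the marked ones
`‖H′ Z₀‖ ≤ A′ e^{−R′ d(Z₀)}`, with the rate ∕ smallness conditions listed (κ₀, K₀ of (1.26), volume constant 4·2^d, degree 2d,
joining costs 5 and 2; free parameters τ, b, r₁, κ₂), then every (3.47) term at the cube `c` obeys
`‖𝐄₀(X, c)‖ ≤ A′ e^{2εe^{2κ}(2d+1)K₀·4·2^d} K₀ · e^{−κ·d(X)}`, `ε = τ·4·2^d·K₀·e^{−b}`. [cite: Balaban1988Convergent, (3.47) p.278] -/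
theorem norm_E0_torus_le_of_letters {H H' : TDom d N → ℂ} (c : TPt d N) {A A' R R' r₁ b τ κ κ₂ : ℝ} (hA : 0 ≤ A)
    (hA' : 0 ≤ A') (hτ : 0 ≤ τ) (hr₁ : 0 ≤ r₁) (hb : r₁ * 5 ≤ b) (hκ : 0 ≤ κ)
    (hH : ∀ Z : TDom d N, ‖H Z‖ ≤ A * Real.exp (-(R * torusTreeLen Z.1)))
    (hH' : ∀ Z₀ : TDom d N, ‖H' Z₀‖ ≤ A' * Real.exp (-(R' * torusTreeLen Z₀.1)))
    (hrate : r₁ + 2 * kappa₀ (4 * 2 ^ d) (2 * d) + 1 + τ * (4 * 2 ^ d) ≤ R)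
    (hsmall : A * Real.exp (b + τ * (4 * 2 ^ d)) * K₀ (4 * 2 ^ d) (2 * d) * (2 * (d : ℝ) + 1) ≤ τ)
    (hε1 : τ * (4 * 2 ^ d) * K₀ (4 * 2 ^ d) (2 * d) * Real.exp (-b) ≤ 1)
    (hrκ : kappa₀ (4 * 2 ^ d) (2 * d) ≤ r₁ - κ) (hκ₂ : kappa₀ (4 * 2 ^ d) (2 * d) ≤ κ₂)
    (hrate' : κ + 2 * (τ * (4 * 2 ^ d) * K₀ (4 * 2 ^ d) (2 * d) * Real.exp (-b)) * Real.exp (κ * 2) *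
        ((2 * (d : ℝ) + 1) * K₀ (4 * 2 ^ d) (2 * d)) * (4 * 2 ^ d) + κ₂ ≤ R')
    (X : Finset (TPt d N)) :
    ‖E0 (Finset.univ.filter fun Z : TDom d N => c ∈ Z.1)
        (fun Z₀ => ((Finset.univ : Finset (TDom d N)).powerset.image
          fun C => C.biUnion fun X => X.1).filter (fun Y => ∃ b ∈ Y, ∃ a ∈ Z₀.1, a = b ∨ TAdj a b))
        (fun Z : TDom d N => Z.1) H' (locE TTouch (fun Z : TDom d N => Z.1) H) X‖ ≤
      A' * Real.exp (2 * (τ * (4 * 2 ^ d) * K₀ (4 * 2 ^ d) (2 * d) * Real.exp (-b)) * Real.exp (κ * 2) *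
          ((2 * (d : ℝ) + 1) * K₀ (4 * 2 ^ d) (2 * d)) * (4 * 2 ^ d)) *
        K₀ (4 * 2 ^ d) (2 * d) * Real.exp (-(κ * torusTreeLen X)) :=
  norm_E0_torus_le_of_decay (isKPVolume_torus_of_decayLetters hA hτ hr₁ hb hH hrate hsmall) c hA hA' hτ hr₁
    hb hκ hH hH' hrate hsmall hε1 hrκ hκ₂ hrate' X



/-- `K₀(c₀, Δ) ≥ 1` for `c₀ ≥ 1`: `K₀ = e^{κ₀}(Δ+1)^{−2}` with `κ₀ = c₀ a₀ ≥ a₀ = log(2(Δ+1)²)` (`…B12TreeDecay`, the (1.26)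
constants of [Balaban1987RG1] in Dimock's explicit form). [folklore] -/
private theorem one_le_K₀' {c₀ : ℝ} (hc₀ : 1 ≤ c₀) (Δ : ℕ) : 1 ≤ K₀ c₀ Δ := by
  have hΔ : (0 : ℝ) < ((Δ : ℝ) + 1) ^ 2 := by positivity
  have ha0 : 0 ≤ B12TreeDecay.a₀ Δ := B12TreeDecay.a₀_nonneg Δ
  have hexp : Real.exp (B12TreeDecay.a₀ Δ) = 2 * ((Δ : ℝ) + 1) ^ 2 := by
    unfold B12TreeDecay.a₀
    exact Real.exp_log (by positivity)
  have hk : B12TreeDecay.a₀ Δ ≤ kappa₀ c₀ Δ := by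
    unfold B12TreeDecay.kappa₀
    nlinarith
  unfold B12TreeDecay.K₀
  rw [le_div_iff₀ hΔ, one_mul]
  calc ((Δ : ℝ) + 1) ^ 2 ≤ 2 * ((Δ : ℝ) + 1) ^ 2 := by nlinarith
    _ = Real.exp (B12TreeDecay.a₀ Δ) := hexp.symm
    _ ≤ Real.exp (kappa₀ c₀ Δ) := Real.exp_le_exp.mpr hk

/-- The (1.26) constant is at least one: `1 ≤ K₀(4·2^d, 2d)` (as in `…B14.Eq347Letters`, private there). [folklore] -/
private theorem one_le_K₀_torus (d : ℕ) : 1 ≤ K₀ (4 * 2 ^ d) (2 * d) := by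
  refine one_le_K₀' ?_ (2 * d)
  have h : (1 : ℝ) ≤ 2 ^ d := one_le_pow₀ (by norm_num)
  linarith

open Classical in
/-- **(3.47) p. 278 ON THE TORUS with the free parameters fixed — «O(1)·A′·e^{−κ d(X)}» for a PRESCRIBED rate `κ ≥ 0`.**
Denominator activities `‖H Z‖ ≤ A e^{−R d(Z)}` and marked activities `‖H′ Z₀‖ ≤ A′ e^{−R′ d(Z₀)}` with
`R ≥ κ + 3κ₀ + 2`, `R′ ≥ κ + κ₀ + 1` and `A · 2(4·2^d)²K₀³(2d+1)²e^{7κ + 5κ₀ + 1} ≤ 1` (κ₀ = κ₀(4·2^d, 2d), K₀ = K₀(4·2^d, 2d)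
of (1.26)) give, for every (3.47) term at the cube `c`,  `‖𝐄₀(X, c)‖ ≤ (e·K₀)·A′·e^{−κ·d(X)}`.  This is `norm_E0_torus_le_of_letters` at the choice
`τ = (4·2^d)⁻¹`, `r₁ = κ + κ₀`, `b = 5r₁ + 2κ + log(2·4·2^d·K₀²·(2d+1))`, `κ₂ = κ₀` (one admissible choice; print: *«with the
constant B₀ replaced by O(p₀³(g_k))»* — here O(1) = e·K₀ depends on `d` only and `A′` carries the `O(p₀³(g_k))`).
[cite: Balaban1988Convergent, (3.47) p.278] -/
theorem norm_E0_torus_le_rate {H H' : TDom d N → ℂ} (c : TPt d N) {A A' R R' κ : ℝ} (hA : 0 ≤ A) (hA' : 0 ≤ A')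
    (hκ : 0 ≤ κ)
    (hH : ∀ Z : TDom d N, ‖H Z‖ ≤ A * Real.exp (-(R * torusTreeLen Z.1)))
    (hH' : ∀ Z₀ : TDom d N, ‖H' Z₀‖ ≤ A' * Real.exp (-(R' * torusTreeLen Z₀.1)))
    (hR : κ + 3 * kappa₀ (4 * 2 ^ d) (2 * d) + 2 ≤ R) (hR' : κ + kappa₀ (4 * 2 ^ d) (2 * d) + 1 ≤ R')
    (hAsmall : A * (2 * (4 * 2 ^ d) ^ 2 * K₀ (4 * 2 ^ d) (2 * d) ^ 3 * (2 * (d : ℝ) + 1) ^ 2 *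
        Real.exp (7 * κ + 5 * kappa₀ (4 * 2 ^ d) (2 * d) + 1)) ≤ 1)
    (X : Finset (TPt d N)) :
    ‖E0 (Finset.univ.filter fun Z : TDom d N => c ∈ Z.1)
        (fun Z₀ => ((Finset.univ : Finset (TDom d N)).powerset.image
          fun C => C.biUnion fun X => X.1).filter (fun Y => ∃ b ∈ Y, ∃ a ∈ Z₀.1, a = b ∨ TAdj a b))
        (fun Z : TDom d N => Z.1) H' (locE TTouch (fun Z : TDom d N => Z.1) H) X‖ ≤
      Real.exp 1 * K₀ (4 * 2 ^ d) (2 * d) * A' * Real.exp (-(κ * torusTreeLen X)) := by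
  -- the constants of the torus geometry (the same as the window's)
  set c₁ : ℝ := 4 * 2 ^ d with hc₁def
  set k₀ : ℝ := kappa₀ (4 * 2 ^ d) (2 * d) with hk₀def
  set K : ℝ := K₀ (4 * 2 ^ d) (2 * d) with hKdef
  set ν : ℝ := 2 * (d : ℝ) + 1 with hνdef
  have h2d : (1 : ℝ) ≤ 2 ^ d := one_le_pow₀ (by norm_num)
  have hc₁ : (4 : ℝ) ≤ c₁ := by rw [hc₁def]; linarith
  have hc₁pos : 0 < c₁ := by linarith
  have hc₁ne : c₁ ≠ 0 := hc₁pos.ne'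
  have hk₀ : 0 ≤ k₀ := kappa₀_nonneg (by positivity) _
  have hK1 : 1 ≤ K := one_le_K₀_torus d
  have hKpos : 0 < K := by linarith
  have hν1 : 1 ≤ ν := by rw [hνdef]; have : (0 : ℝ) ≤ d := Nat.cast_nonneg d; linarith
  have hνpos : 0 < ν := by linarith
  -- the choice of the free parameters
  set τ : ℝ := c₁⁻¹ with hτdef
  set r₁ : ℝ := κ + k₀ with hr₁def
  set P : ℝ := 2 * c₁ * K ^ 2 * ν with hPdef
  set b : ℝ := r₁ * 5 + (κ * 2 + Real.log P) with hbdef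
  have hτpos : 0 < τ := inv_pos.mpr hc₁pos
  have hτc : τ * c₁ = 1 := inv_mul_cancel₀ hc₁ne
  have hr₁ : 0 ≤ r₁ := add_nonneg hκ hk₀
  have h2cKν : 1 ≤ 2 * c₁ * K * ν := by
    have h1 : c₁ ≤ c₁ * K := le_mul_of_one_le_right hc₁pos.le hK1
    have h2 : c₁ * K ≤ c₁ * K * ν := le_mul_of_one_le_right (by positivity) hν1
    linarith
  have hKP : K ≤ P := by
    -- `K ≤ 2 c₁ K² ν` since `1 ≤ 2 c₁ K ν`
    have h := mul_le_mul_of_nonneg_left h2cKν hKpos.le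
    calc K = K * 1 := (mul_one K).symm
      _ ≤ K * (2 * c₁ * K * ν) := h
      _ = P := by rw [hPdef]; ring
  have hP1 : 1 ≤ P := le_trans hK1 hKP
  have hPpos : 0 < P := by linarith
  have hexpb : Real.exp b = Real.exp (r₁ * 5) * (Real.exp (κ * 2) * P) := by
    rw [hbdef, Real.exp_add, Real.exp_add, Real.exp_log hPpos]
  have hexpb_ge : P ≤ Real.exp b := by
    rw [hexpb]
    have h5 : 1 ≤ Real.exp (r₁ * 5) := Real.one_le_exp (by positivity)
    have h2 : 1 ≤ Real.exp (κ * 2) := Real.one_le_exp (by positivity)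
    have h := mul_le_mul h5 (mul_le_mul h2 (le_refl P) hPpos.le (by positivity)) (by positivity) (by positivity)
    simpa using h
  -- the quantity `Q = 2εe^{2κ}(νK)c₁` of `norm_E0_torus_le_of_letters` equals `e^{−5r₁}` at this choice
  have hQ : 2 * (τ * (4 * 2 ^ d) * K * Real.exp (-b)) * Real.exp (κ * 2) * (ν * K) * (4 * 2 ^ d) =
      Real.exp (-(r₁ * 5)) := by
    rw [← hc₁def, hτdef, Real.exp_neg, Real.exp_neg, hexpb, hPdef]
    have hE5 : Real.exp (r₁ * 5) ≠ 0 := (Real.exp_pos _).ne'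
    have hE2 : Real.exp (κ * 2) ≠ 0 := (Real.exp_pos _).ne'
    field_simp
  have hQ1 : Real.exp (-(r₁ * 5)) ≤ 1 := Real.exp_le_one_iff.mpr (by linarith)
  have hb5 : r₁ * 5 ≤ b := by
    rw [hbdef]
    linarith [Real.log_nonneg hP1]
  -- `norm_E0_torus_le_of_letters` at this choice
  have hmain := norm_E0_torus_le_of_letters c (A := A) (A' := A') (R := R) (R' := R') (r₁ := r₁) (b := b)
    (τ := τ) (κ := κ) (κ₂ := k₀) hA hA' hτpos.le hr₁ hb5 hκ hH hH' ?_ ?_ ?_ ?_ le_rfl ?_ X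
  · refine hmain.trans ?_
    rw [hQ]
    have hexpQ : Real.exp (Real.exp (-(r₁ * 5))) ≤ Real.exp 1 := Real.exp_le_exp.mpr hQ1
    have hlast : 0 ≤ Real.exp (-(κ * torusTreeLen X)) := Real.exp_nonneg _
    calc A' * Real.exp (Real.exp (-(r₁ * 5))) * K * Real.exp (-(κ * torusTreeLen X))
        ≤ A' * Real.exp 1 * K * Real.exp (-(κ * torusTreeLen X)) := by gcongr
      _ = Real.exp 1 * K * A' * Real.exp (-(κ * torusTreeLen X)) := by ring
  · -- rate: `r₁ + 2κ₀ + 1 + τc₁ = κ + 3κ₀ + 2 ≤ R`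
    rw [← hc₁def, hτc]
    linarith
  · -- smallness: `A e^{b+1} K ν ≤ τ`
    rw [← hc₁def, hτc]
    have hE : Real.exp (b + 1) = Real.exp (7 * κ + 5 * k₀ + 1) * P := by
      rw [Real.exp_add, hexpb]
      have h3 : Real.exp (7 * κ + 5 * k₀ + 1) = Real.exp (r₁ * 5) * Real.exp (κ * 2) * Real.exp 1 := by
        rw [← Real.exp_add, ← Real.exp_add]
        congr 1
        rw [hr₁def]
        ring
      rw [h3]
      ring
    have hlhs : A * Real.exp (b + 1) * K * ν =
        A * (2 * c₁ ^ 2 * K ^ 3 * ν ^ 2 * Real.exp (7 * κ + 5 * k₀ + 1)) * τ := by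
      rw [hE, hPdef, hτdef]
      field_simp
    rw [hlhs]
    have := mul_le_mul_of_nonneg_right hAsmall hτpos.le
    simpa using this
  · -- `ε = τc₁K e^{−b} = K e^{−b} ≤ 1`
    rw [← hc₁def, hτc, one_mul, Real.exp_neg]
    rw [mul_inv_le_iff₀ (Real.exp_pos b), one_mul]
    exact hKP.trans hexpb_ge
  · -- `κ₀ ≤ r₁ − κ`
    rw [hr₁def]
    linarith
  · -- rate of the marked activities: `κ + Q + κ₀ ≤ R′`
    rw [hQ]
    linarith



open Classical in
/-- **THE INDUCTIVE-BOUND SHAPE FOR THE (3.47) TERMS ON THE TORUS** (p. 279: *«These terms satisfy all the conditions of the inductive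
assumption»*; p. 262: the newly created terms *«have better decay properties, with the number κ replaced, for example, by
(1+4β)κ»*): for a TARGET constant `M` and a TARGET rate `κ⋆ ≥ 0` — read `κ⋆ := (1+4β)κ` and `M := E₀` for 𝐄^{(k+1)} (bound
(I.1.18) ∕ (2.27)(iv)), `M := g^{κ₀}` for 𝐑″^{(k+1)} ((2.31)), `M := B₀` for 𝐁^{(k+1)} ((2.42)), i.e. the three fields
`boundE ∕ boundR ∕ boundB` of `Step.LFHypImproved` at the new index — activity letters at rates `R ≥ κ⋆ + 3κ₀ + 2`,
`R′ ≥ κ⋆ + κ₀ + 1` with the unmarked smallness of `norm_E0_torus_le_rate` and the marked amplitude `e·K₀·A′ ≤ M` give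
`‖𝐄₀(X, c)‖ ≤ M·e^{−κ⋆·d(X)}` for every (3.47) term. [cite: Balaban1988Convergent, p.279 and p.262] -/
theorem norm_E0_torus_le_target {H H' : TDom d N → ℂ} (c : TPt d N) {A A' R R' κt M : ℝ} (hA : 0 ≤ A) (hA' : 0 ≤ A')
    (hκt : 0 ≤ κt)
    (hH : ∀ Z : TDom d N, ‖H Z‖ ≤ A * Real.exp (-(R * torusTreeLen Z.1)))
    (hH' : ∀ Z₀ : TDom d N, ‖H' Z₀‖ ≤ A' * Real.exp (-(R' * torusTreeLen Z₀.1)))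
    (hR : κt + 3 * kappa₀ (4 * 2 ^ d) (2 * d) + 2 ≤ R) (hR' : κt + kappa₀ (4 * 2 ^ d) (2 * d) + 1 ≤ R')
    (hAsmall : A * (2 * (4 * 2 ^ d) ^ 2 * K₀ (4 * 2 ^ d) (2 * d) ^ 3 * (2 * (d : ℝ) + 1) ^ 2 *
        Real.exp (7 * κt + 5 * kappa₀ (4 * 2 ^ d) (2 * d) + 1)) ≤ 1)
    (hM : Real.exp 1 * K₀ (4 * 2 ^ d) (2 * d) * A' ≤ M) (X : Finset (TPt d N)) :
    ‖E0 (Finset.univ.filter fun Z : TDom d N => c ∈ Z.1)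
        (fun Z₀ => ((Finset.univ : Finset (TDom d N)).powerset.image
          fun C => C.biUnion fun X => X.1).filter (fun Y => ∃ b ∈ Y, ∃ a ∈ Z₀.1, a = b ∨ TAdj a b))
        (fun Z : TDom d N => Z.1) H' (locE TTouch (fun Z : TDom d N => Z.1) H) X‖ ≤
      M * Real.exp (-(κt * torusTreeLen X)) :=
  (norm_E0_torus_le_rate c hA hA' hκt hH hH' hR hR' hAsmall X).trans
    (mul_le_mul_of_nonneg_right hM (Real.exp_nonneg _))

open Classical in
/-- **The literal `(1+4β)κ` instance on the torus** (p. 262 *«for example, by (1+4β)κ»*; `Step.LFHypImproved`'s exponent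
`−((1 + 4β)κ)·d`): with `β, κ ≥ 0`, letters at rates `R ≥ (1+4β)κ + 3κ₀ + 2`, `R′ ≥ (1+4β)κ + κ₀ + 1`, the unmarked
smallness at rate `(1+4β)κ` and `e·K₀·A′ ≤ M`:  `‖𝐄₀(X, c)‖ ≤ M·exp(−((1+4β)κ)·d(X))`. [cite: Balaban1988Convergent, p.262] -/
theorem norm_E0_torus_le_improved {H H' : TDom d N → ℂ} (c : TPt d N) {A A' R R' βc κ M : ℝ} (hA : 0 ≤ A) (hA' : 0 ≤ A')
    (hβ : 0 ≤ βc) (hκ : 0 ≤ κ)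
    (hH : ∀ Z : TDom d N, ‖H Z‖ ≤ A * Real.exp (-(R * torusTreeLen Z.1)))
    (hH' : ∀ Z₀ : TDom d N, ‖H' Z₀‖ ≤ A' * Real.exp (-(R' * torusTreeLen Z₀.1)))
    (hR : (1 + 4 * βc) * κ + 3 * kappa₀ (4 * 2 ^ d) (2 * d) + 2 ≤ R)
    (hR' : (1 + 4 * βc) * κ + kappa₀ (4 * 2 ^ d) (2 * d) + 1 ≤ R')
    (hAsmall : A * (2 * (4 * 2 ^ d) ^ 2 * K₀ (4 * 2 ^ d) (2 * d) ^ 3 * (2 * (d : ℝ) + 1) ^ 2 *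
        Real.exp (7 * ((1 + 4 * βc) * κ) + 5 * kappa₀ (4 * 2 ^ d) (2 * d) + 1)) ≤ 1)
    (hM : Real.exp 1 * K₀ (4 * 2 ^ d) (2 * d) * A' ≤ M) (X : Finset (TPt d N)) :
    ‖E0 (Finset.univ.filter fun Z : TDom d N => c ∈ Z.1)
        (fun Z₀ => ((Finset.univ : Finset (TDom d N)).powerset.image
          fun C => C.biUnion fun X => X.1).filter (fun Y => ∃ b ∈ Y, ∃ a ∈ Z₀.1, a = b ∨ TAdj a b))
        (fun Z : TDom d N => Z.1) H' (locE TTouch (fun Z : TDom d N => Z.1) H) X‖ ≤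
      M * Real.exp (-((1 + 4 * βc) * κ) * torusTreeLen X) := by
  have hκt : 0 ≤ (1 + 4 * βc) * κ := by positivity
  have h := norm_E0_torus_le_target c hA hA' hκt hH hH' hR hR' hAsmall hM X
  have he : -((1 + 4 * βc) * κ) * torusTreeLen X = -((1 + 4 * βc) * κ * torusTreeLen X) := by ring
  rw [he]
  exact h

end Letters

end Literature.MathematicalPhysics.QuantumFieldTheory.Balaban1983to89.B14.Eq347Torus
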